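import Mathlib
import HarnessLib

/-!
# Route LiouvilleSarnak — crux `LiouvilleCutRank` (stmt-ValiantsHypothesis-14775): third barrier — the dyadic
# identity TOGETHER WITH non-automaticity-type freedom still allows rank ONE on the interleaved prototype

`…DyadicBarrier.lean` (p824931): the Thue–Morse sign has `g(2m) = -g(m)` and ALL cut ranks `≤ 1` — but it is
`2`-automatic, and the aligned rung of the crux was proved exactly from non-automaticity (Coons).  Could
`λ(2m) = -λ(m)` plus non-automaticity (plus the aligned rung) settle the finely interleaved Class A?  NO: this file
exhibits, for EVERY sign colouring `x : ℕ → {±1}` satisfying the single constraint `x(4R+1) = -x(R)` — the values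
`x(4R)` are completely free, so there are `2^ℵ₀` such `x`, among them non-automatic ones and ones whose aligned cut
ranks are unbounded — a function `f_x(1+N) = x(R(N)) · x(C(N))` (`R(N)`, `C(N)` = the numbers formed by the odd-position, resp.
even-position, bits of `N`) with

* `f_two_mul` — `f_x(2m) = -f_x(m)` for all `m ≥ 1` (because `R(2N+1) = C(N)` and `C(2N+1) = 4R(N) + 1`);
* `f_eq_one_or` — values `±1`;
* ★ `rank_interleaved_f_le_one` — EVERY interleaved cut matrix `(f_x(N_π(r,c)+1))_{r,c}` (column bit `i` at position
  `2i`, row bit `i` at `2i+1`, any level `n`) has rank `≤ 1` (it is the outer product `x(P(r)) x(P(c))`).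

So any proof of `LiouvilleCutRank` on Class A must use an input violated by some `f_x` with non-automatic `x`:
odd-prime multiplicativity or analytic information about `λ` (cf. the census on the item).  Honest framing: a barrier
lemma, no case of the crux; `LiouvilleCutRank`, `DigitalBilinearLiouville`, `AlgebraicSarnak` stay OPEN; nothing bears on
`VP ≠ VNP`.  No definitions (the digit extractions are explicit finite sums); imports `Mathlib` only.
-/

set_option linter.dupNamespace false

noncomputable section

namespace Summit.ValiantsHypothesis.ValiantsHypothesis.Theorems.LiouvilleSarnakLiouvilleCutRank.AutomaticityBarrier

open Finset

/-! ### §1 Odd- and even-position digit extraction `R(N) = Σ_i N_{2i+1} 4^i`, `C(N) = Σ_i N_{2i} 4^i` -/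

/-- Bits of `N` vanish from position `N + 1` on (indeed from `⌊log₂ N⌋ + 1`). [folklore] -/
theorem testBit_eq_false_of_le {N j : ℕ} (h : N + 1 ≤ j) : N.testBit j = false :=
  Nat.testBit_eq_false_of_lt (lt_of_lt_of_le (Nat.lt_two_pow_self) (Nat.pow_le_pow_right (by norm_num) (by omega)))

/-- Extending the range of the odd-position digit sum does not change it. [folklore] -/
theorem sum_oddBits_range_eq {N A : ℕ} (hA : N + 1 ≤ A) :
    (∑ i ∈ Finset.range A, (N.testBit (2 * i + 1)).toNat * 4 ^ i) =
      ∑ i ∈ Finset.range (N + 1), (N.testBit (2 * i + 1)).toNat * 4 ^ i := by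
  symm
  apply Finset.sum_subset (Finset.range_subset_range.mpr hA)
  intro i hi hi'
  simp only [Finset.mem_range, not_lt] at hi hi'
  rw [testBit_eq_false_of_le (by omega)]
  simp

/-- Extending the range of the even-position digit sum does not change it. [folklore] -/
theorem sum_evenBits_range_eq {N A : ℕ} (hA : N + 1 ≤ A) :
    (∑ i ∈ Finset.range A, (N.testBit (2 * i)).toNat * 4 ^ i) =
      ∑ i ∈ Finset.range (N + 1), (N.testBit (2 * i)).toNat * 4 ^ i := by
  symm
  apply Finset.sum_subset (Finset.range_subset_range.mpr hA)
  intro i hi hi'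
  simp only [Finset.mem_range, not_lt] at hi hi'
  rw [testBit_eq_false_of_le (by omega)]
  simp

/-- `R(2N+1) = C(N)`: the odd-position bits of `2N+1` are the even-position bits of `N`. [folklore] -/
theorem oddBits_two_mul_add_one (N : ℕ) :
    (∑ i ∈ Finset.range (2 * N + 1 + 1), ((2 * N + 1).testBit (2 * i + 1)).toNat * 4 ^ i) =
      ∑ i ∈ Finset.range (N + 1), (N.testBit (2 * i)).toNat * 4 ^ i := by
  have h : ∀ i, (2 * N + 1).testBit (2 * i + 1) = N.testBit (2 * i) := by
    intro i
    rw [Nat.testBit_succ]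
    congr 1
    omega
  simp_rw [h]
  exact sum_evenBits_range_eq (by omega)

/-- `C(2N+1) = 4 R(N) + 1`: the even-position bits of `2N+1` are a bottom `1` and the odd-position bits of `N` shifted.
[folklore] -/
theorem evenBits_two_mul_add_one (N : ℕ) :
    (∑ i ∈ Finset.range (2 * N + 1 + 1), ((2 * N + 1).testBit (2 * i)).toNat * 4 ^ i) =
      4 * (∑ i ∈ Finset.range (N + 1), (N.testBit (2 * i + 1)).toNat * 4 ^ i) + 1 := by
  rw [Finset.sum_range_succ']
  have h0 : ((2 * N + 1).testBit (2 * 0)).toNat * 4 ^ 0 = 1 := by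
    rw [mul_zero, pow_zero, mul_one, Nat.testBit_zero]
    simp [Nat.add_mod]
  have h : ∀ i, (2 * N + 1).testBit (2 * (i + 1)) = N.testBit (2 * i + 1) := by
    intro i
    rw [show 2 * (i + 1) = (2 * i + 1) + 1 by ring, Nat.testBit_succ]
    congr 1
    omega
  rw [h0]
  simp_rw [h]
  rw [← sum_oddBits_range_eq (by omega : N + 1 ≤ 2 * N + 1), Finset.mul_sum]
  congr 1
  exact Finset.sum_congr rfl fun i _ => by ring

/-! ### §2 The interleaved cut number and its digit extractions -/

/-- For the interleaved cut (row bit `i` at position `2i+1`, column bit `i` at position `2i`), the odd-position digit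
extraction of `N_π(r,c)` is `P(r) = Σ_i [r i] 4^i`. [folklore] -/
theorem oddBits_interleaved (n : ℕ) (π : Fin n ⊕ Fin n ≃ Fin (2 * n))
    (hπ : ∀ i : Fin n, (π (Sum.inl i) : ℕ) = 2 * i + 1 ∧ (π (Sum.inr i) : ℕ) = 2 * i)
    (r c : Fin n → Bool) :
    (∑ i ∈ Finset.range (Nat.ofBits (fun j : Fin (2 * n) => Sum.elim r c (π.symm j)) + 1),
        ((Nat.ofBits (fun j : Fin (2 * n) => Sum.elim r c (π.symm j))).testBit (2 * i + 1)).toNat * 4 ^ i) =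
      ∑ i : Fin n, (r i).toNat * 4 ^ (i : ℕ) := by
  classical
  set N := Nat.ofBits (fun j : Fin (2 * n) => Sum.elim r c (π.symm j)) with hN
  -- the bit of `N` at position `2i+1`
  have hbit : ∀ i : ℕ, N.testBit (2 * i + 1) = if h : i < n then r ⟨i, h⟩ else false := by
    intro i
    rw [hN, Nat.testBit_ofBits]
    by_cases h : i < n
    · rw [dif_pos (by omega : 2 * i + 1 < 2 * n), dif_pos h]
      have hj : π.symm ⟨2 * i + 1, by omega⟩ = Sum.inl ⟨i, h⟩ := by
        rw [Equiv.symm_apply_eq]; ext; exact ((hπ ⟨i, h⟩).1).symm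
      rw [hj, Sum.elim_inl]
    · rw [dif_neg (by omega : ¬ 2 * i + 1 < 2 * n), dif_neg h]
  -- both sides as sums over `range (max (N+1) n)` of the same summand
  have hL : (∑ i ∈ Finset.range (N + 1), (N.testBit (2 * i + 1)).toNat * 4 ^ i) =
      ∑ i ∈ Finset.range (max (N + 1) n), (N.testBit (2 * i + 1)).toNat * 4 ^ i :=
    (sum_oddBits_range_eq (le_max_left _ _)).symm
  have hR : (∑ i : Fin n, (r i).toNat * 4 ^ (i : ℕ)) =
      ∑ i ∈ Finset.range (max (N + 1) n), (N.testBit (2 * i + 1)).toNat * 4 ^ i := by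
    have h1 : (∑ i : Fin n, (r i).toNat * 4 ^ (i : ℕ)) =
        ∑ i : Fin n, (N.testBit (2 * (i : ℕ) + 1)).toNat * 4 ^ (i : ℕ) :=
      Finset.sum_congr rfl fun i _ => by rw [hbit i, dif_pos i.isLt]
    rw [h1, Fin.sum_univ_eq_sum_range (fun i => (N.testBit (2 * i + 1)).toNat * 4 ^ i) n]
    apply Finset.sum_subset (Finset.range_subset_range.mpr (le_max_right _ _))
    intro i hi hi'
    simp only [Finset.mem_range, not_lt] at hi hi'
    rw [hbit i, dif_neg (by omega)]
    simp
  rw [hL, hR]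

/-- Dually, the even-position digit extraction of `N_π(r,c)` is `P(c)`. [folklore] -/
theorem evenBits_interleaved (n : ℕ) (π : Fin n ⊕ Fin n ≃ Fin (2 * n))
    (hπ : ∀ i : Fin n, (π (Sum.inl i) : ℕ) = 2 * i + 1 ∧ (π (Sum.inr i) : ℕ) = 2 * i)
    (r c : Fin n → Bool) :
    (∑ i ∈ Finset.range (Nat.ofBits (fun j : Fin (2 * n) => Sum.elim r c (π.symm j)) + 1),
        ((Nat.ofBits (fun j : Fin (2 * n) => Sum.elim r c (π.symm j))).testBit (2 * i)).toNat * 4 ^ i) =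
      ∑ i : Fin n, (c i).toNat * 4 ^ (i : ℕ) := by
  classical
  set N := Nat.ofBits (fun j : Fin (2 * n) => Sum.elim r c (π.symm j)) with hN
  have hbit : ∀ i : ℕ, N.testBit (2 * i) = if h : i < n then c ⟨i, h⟩ else false := by
    intro i
    rw [hN, Nat.testBit_ofBits]
    by_cases h : i < n
    · rw [dif_pos (by omega : 2 * i < 2 * n), dif_pos h]
      have hj : π.symm ⟨2 * i, by omega⟩ = Sum.inr ⟨i, h⟩ := by
        rw [Equiv.symm_apply_eq]; ext; exact ((hπ ⟨i, h⟩).2).symm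
      rw [hj, Sum.elim_inr]
    · rw [dif_neg (by omega : ¬ 2 * i < 2 * n), dif_neg h]
  have hL : (∑ i ∈ Finset.range (N + 1), (N.testBit (2 * i)).toNat * 4 ^ i) =
      ∑ i ∈ Finset.range (max (N + 1) n), (N.testBit (2 * i)).toNat * 4 ^ i :=
    (sum_evenBits_range_eq (le_max_left _ _)).symm
  have hR : (∑ i : Fin n, (c i).toNat * 4 ^ (i : ℕ)) =
      ∑ i ∈ Finset.range (max (N + 1) n), (N.testBit (2 * i)).toNat * 4 ^ i := by
    have h1 : (∑ i : Fin n, (c i).toNat * 4 ^ (i : ℕ)) =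
        ∑ i : Fin n, (N.testBit (2 * (i : ℕ))).toNat * 4 ^ (i : ℕ) :=
      Finset.sum_congr rfl fun i _ => by rw [hbit i, dif_pos i.isLt]
    rw [h1, Fin.sum_univ_eq_sum_range (fun i => (N.testBit (2 * i)).toNat * 4 ^ i) n]
    apply Finset.sum_subset (Finset.range_subset_range.mpr (le_max_right _ _))
    intro i hi hi'
    simp only [Finset.mem_range, not_lt] at hi hi'
    rw [hbit i, dif_neg (by omega)]
    simp
  rw [hL, hR]

/-! ### §3 The barrier -/

/-- ★ **Dyadic identity + freedom of a non-automatic colouring, still rank one on the interleaved prototype.**  For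
EVERY `x : ℕ → ℤ` with values `±1` and `x(4R+1) = -x(R)` for all `R` (the values `x(4R)` are unconstrained), the
function `f(m) = x(R(m-1)) · x(C(m-1))` (`R`, `C` = the odd-position and even-position digit extractions) satisfies
`f(2m) = -f(m)` (`m ≥ 1`), takes values `±1`, and EVERY interleaved cut matrix `(f(N_π(r,c)+1))_{r,c}` has rank `≤ 1`.
[folklore] -/
theorem dyadic_nonautomatic_barrier (x : ℕ → ℤ) (hx1 : ∀ m, x m = 1 ∨ x m = -1)
    (hx : ∀ R, x (4 * R + 1) = -x R) :
    (∀ m, 1 ≤ m →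
      (fun m : ℕ => x (∑ i ∈ Finset.range (m - 1 + 1), ((m - 1).testBit (2 * i + 1)).toNat * 4 ^ i) *
        x (∑ i ∈ Finset.range (m - 1 + 1), ((m - 1).testBit (2 * i)).toNat * 4 ^ i)) (2 * m) =
      -(fun m : ℕ => x (∑ i ∈ Finset.range (m - 1 + 1), ((m - 1).testBit (2 * i + 1)).toNat * 4 ^ i) *
        x (∑ i ∈ Finset.range (m - 1 + 1), ((m - 1).testBit (2 * i)).toNat * 4 ^ i)) m) ∧
    (∀ m, (fun m : ℕ => x (∑ i ∈ Finset.range (m - 1 + 1), ((m - 1).testBit (2 * i + 1)).toNat * 4 ^ i) *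
        x (∑ i ∈ Finset.range (m - 1 + 1), ((m - 1).testBit (2 * i)).toNat * 4 ^ i)) m = 1 ∨
      (fun m : ℕ => x (∑ i ∈ Finset.range (m - 1 + 1), ((m - 1).testBit (2 * i + 1)).toNat * 4 ^ i) *
        x (∑ i ∈ Finset.range (m - 1 + 1), ((m - 1).testBit (2 * i)).toNat * 4 ^ i)) m = -1) ∧
    ∀ (n : ℕ) (π : Fin n ⊕ Fin n ≃ Fin (2 * n)),
      (∀ i : Fin n, (π (Sum.inl i) : ℕ) = 2 * i + 1 ∧ (π (Sum.inr i) : ℕ) = 2 * i) →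
      (Matrix.of fun r c : Fin n → Bool =>
        (((fun m : ℕ => x (∑ i ∈ Finset.range (m - 1 + 1), ((m - 1).testBit (2 * i + 1)).toNat * 4 ^ i) *
            x (∑ i ∈ Finset.range (m - 1 + 1), ((m - 1).testBit (2 * i)).toNat * 4 ^ i))
          (Nat.ofBits (fun j : Fin (2 * n) => Sum.elim r c (π.symm j)) + 1) : ℤ) : ℂ)).rank ≤ 1 := by
  refine ⟨fun m hm => ?_, fun m => ?_, fun n π hπ => ?_⟩
  · -- `f(2m) = -f(m)`: with `N = m - 1`, `2m - 1 = 2N + 1`, `R(2N+1) = C(N)`, `C(2N+1) = 4R(N)+1`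
    obtain ⟨N, rfl⟩ : ∃ N, m = N + 1 := ⟨m - 1, by omega⟩
    simp only [Nat.add_sub_cancel, show 2 * (N + 1) - 1 = 2 * N + 1 by omega]
    rw [oddBits_two_mul_add_one, evenBits_two_mul_add_one, hx]
    ring
  · simp only
    rcases hx1 (∑ i ∈ Finset.range (m - 1 + 1), ((m - 1).testBit (2 * i + 1)).toNat * 4 ^ i) with h1 | h1 <;>
      rcases hx1 (∑ i ∈ Finset.range (m - 1 + 1), ((m - 1).testBit (2 * i)).toNat * 4 ^ i) with h2 | h2 <;>
      simp [h1, h2]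
  · classical
    have hentry : ∀ r c : Fin n → Bool,
        (fun m : ℕ => x (∑ i ∈ Finset.range (m - 1 + 1), ((m - 1).testBit (2 * i + 1)).toNat * 4 ^ i) *
            x (∑ i ∈ Finset.range (m - 1 + 1), ((m - 1).testBit (2 * i)).toNat * 4 ^ i))
          (Nat.ofBits (fun j : Fin (2 * n) => Sum.elim r c (π.symm j)) + 1) =
        x (∑ i : Fin n, (r i).toNat * 4 ^ (i : ℕ)) * x (∑ i : Fin n, (c i).toNat * 4 ^ (i : ℕ)) := by
      intro r c
      simp only [Nat.add_sub_cancel]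
      rw [oddBits_interleaved n π hπ r c, evenBits_interleaved n π hπ r c]
    have hM : (Matrix.of fun r c : Fin n → Bool =>
        (((fun m : ℕ => x (∑ i ∈ Finset.range (m - 1 + 1), ((m - 1).testBit (2 * i + 1)).toNat * 4 ^ i) *
            x (∑ i ∈ Finset.range (m - 1 + 1), ((m - 1).testBit (2 * i)).toNat * 4 ^ i))
          (Nat.ofBits (fun j : Fin (2 * n) => Sum.elim r c (π.symm j)) + 1) : ℤ) : ℂ)) =
      Matrix.vecMulVec (fun r : Fin n → Bool => ((x (∑ i : Fin n, (r i).toNat * 4 ^ (i : ℕ)) : ℤ) : ℂ))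
        (fun c : Fin n → Bool => ((x (∑ i : Fin n, (c i).toNat * 4 ^ (i : ℕ)) : ℤ) : ℂ)) := by
      ext r c
      rw [Matrix.of_apply, Matrix.vecMulVec_apply, hentry, Int.cast_mul]
    rw [hM]
    exact Matrix.rank_vecMulVec_le _ _


/-! ## Appended 2026-08-31 (leafhand-val-liouvillesarnak-2 g3): the admissible colourings form a family indexed by
ALL sign sequences -/

/-- **The hypothesis class of `dyadic_nonautomatic_barrier` is as large as possible.**  For EVERY sign sequence
`h : ℕ → {±1}` there is a colouring `x : ℕ → {±1}` with `x(4R+1) = -x(R)` for all `R` AND `x(4R) = h(R)` for all `R`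
(so `h ↦ x` is injective: `2^ℵ₀` admissible colourings, in particular non-automatic ones).  Construction: well-founded
recursion on `m` — `x(m) = -x(m/4)` if `m ≡ 1 (mod 4)`, else `x(m) = h(m/4)`. [folklore] -/
theorem exists_colouring_of_signs (h : ℕ → ℤ) (hh : ∀ m, h m = 1 ∨ h m = -1) :
    ∃ x : ℕ → ℤ, (∀ m, x m = 1 ∨ x m = -1) ∧ (∀ R, x (4 * R + 1) = -x R) ∧ (∀ R, x (4 * R) = h R) := by
  classical
  -- the recursion functional
  let F : ∀ m : ℕ, (∀ k : ℕ, k < m → ℤ) → ℤ := fun m IH =>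
    if hm : m % 4 = 1 then -(IH (m / 4) (by omega)) else h (m / 4)
  let x : ℕ → ℤ := fun m => WellFounded.fix (measure id).wf (fun m IH => F m (fun k hk => IH k hk)) m
  have hfix : ∀ m, x m = F m (fun k _ => x k) := fun m =>
    WellFounded.fix_eq (measure id).wf (fun m IH => F m (fun k hk => IH k hk)) m
  have hx1 : ∀ R, x (4 * R + 1) = -x R := by
    intro R
    rw [hfix]
    simp only [F, dif_pos (show (4 * R + 1) % 4 = 1 by omega)]
    congr 2
    omega
  have hx0 : ∀ R, x (4 * R) = h R := by
    intro R
    rw [hfix]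
    simp only [F, dif_neg (show ¬ (4 * R) % 4 = 1 by omega)]
    congr 1
    omega
  refine ⟨x, fun m => ?_, hx1, hx0⟩
  induction m using Nat.strong_induction_on with
  | _ m ih =>
    rw [hfix]
    by_cases hm : m % 4 = 1
    · simp only [F, dif_pos hm]
      rcases ih (m / 4) (by omega) with h1 | h1 <;> simp [h1]
    · simp only [F, dif_neg hm]
      exact hh _

end Summit.ValiantsHypothesis.ValiantsHypothesis.Theorems.LiouvilleSarnakLiouvilleCutRank.AutomaticityBarrier
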